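import Mathlib
import Summits.Ventures.HodgeRepro.Tier4.Line4.IntegProper
import Summits.Ventures.HodgeRepro.Tier4.Line4.LevelShrink
import Summits.Ventures.HodgeRepro.Tier4.Line4.OrbitProper

/-!
# Tier4/Line4/LevelFibreCompact — the fibre-compactness input `(C, hC, hsub)` of PHASE-AT-P from PROPER and ZDOMAIN-EX (iv)

Blind re-derivation cell `pub-hodge-repro`, Tier 4 «prove the step» (README §9–§10), seat t4-L4-p1 (prover, LINE L4,
gen 5; plan-4 g7's S15912 (2) = g4's ENDING open item).  Tree path
`lean/Summits/Ventures/HodgeRepro/Tier4/Line4/LevelFibreCompact.lean`.  Mathlib-level; no literature.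

WHAT IS PROVED.  `exists_level_pPhase_close` (LevelPhaseAtP) and x2's `finnv_of_pPhase_of_split` (FinNVGlue) take a compact
`C ⊆ T_f × T′_f` and a level `n₁` with
`hsub : ∀ N ≥ n₁, ∀ q ∈ suppSet γ₀ (p^N) γ₀, q.1 ∈ DZ_f → q ∈ C`
(the `DZ_f`-cut level fibres of `γ₀` lie in one compact from level `n₁` on).  Here that triple is PRODUCED:
* **`exists_compact_suppSet_cut_subset`** — under PROPER (`HasProperFinOrbit W γ₀`, L2-p3's C-L4-PROPER as the tree's
  predicate) and ZDOMAIN-EX (iv) for `DZ_f` (`hDZc : closure (DZ_f ∩ C·Z_f)` compact for every compact `C` — the clause of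
  L2-p2's product domain `exists_isFundamentalDomain_prod_univ_of_isCompact_at`, and of typer-2's
  `exists_fundamentalDomain_of_discrete_of_central_cocompact`), for every `p ≠ 0` and every `n₁` there is a compact
  `C ⊆ T_f × T′_f` with `hsub` at `n₁`: L2-p1's compactness lemma `mem_compact_of_hasProperFinOrbit` at the compact double
  coset `K(p^{n₁}) γ₀,f K(p^{n₁})` gives `K₁ × K₂`; a pair of `suppSet γ₀ (p^N) γ₀` with `N ≥ n₁` has its orbit in
  `K(p^N) γ₀,f K(p^N) ⊆ K(p^{n₁}) γ₀,f K(p^{n₁})` (`levelDoubleCoset_pow_antitone`), so it lies in `K₁ × K₂`;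
* `exists_compact_suppSet_cut_subset_of_isLinRegular` — the same with PROPER discharged by L2-p3's
  `hasProperFinOrbit_of_isLinRegular` (`hdet : W.B.det ≠ 0`, `hg : IsGenuineRow W`, `hreg : IsLinRegular W γ₀`).
No display is introduced: the two binders `hprop`/`hDZc` are the line's own theorems at the seesaw plane and the product
domain of record.

Nothing here says anything about the status of the Hodge conjecture for CM abelian varieties, which is NOT proved
(HC_CM is NOT proved by anyone in this repository).
-/

set_option autoImplicit false

noncomputable section

namespace Summit.Ventures.HodgeRepro.Tier4.Line4

open Summit.Ventures.HodgeRepro.Tier4 Summit.Ventures.HodgeRepro.Tier4.Common Summit.Ventures.HodgeRepro.Tier4.Line1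
open scoped Pointwise

section LevelFibreCompact

variable {k : Type} [Field k] [NumberField k] (W : PlaneData k)

/-- **The fibre-compactness input of PHASE-AT-P** from PROPER and ZDOMAIN-EX (iv): a compact `C ⊆ T_f × T′_f` containing
every `DZ_f`-cut level fibre pair of `γ₀` from level `p^{n₁}` on. -/
theorem exists_compact_suppSet_cut_subset (γ₀ : GA W) (hprop : HasProperFinOrbit W γ₀) (DZf : Set (torusFin W))
    (hDZc : ∀ C : Set (torusFin W), IsCompact C → IsCompact (closure (DZf ∩ (C * (ZfIn W : Set (torusFin W))))))
    {p : ℕ} (hp : p ≠ 0) (n₁ : ℕ) :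
    ∃ C : Set (torusFin W × torusFin' W), IsCompact C ∧
      ∀ N ≥ n₁, ∀ q ∈ suppSet W γ₀ (p ^ N) γ₀, q.1 ∈ DZf → q ∈ C := by
  obtain ⟨K₁, K₂, hK₁, hK₂, hmem⟩ := mem_compact_of_hasProperFinOrbit W γ₀ hprop DZf hDZc
    (levelDoubleCoset W (p ^ n₁) (GA.ofFinPart W γ₀)) (isCompact_levelDoubleCoset W (pow_ne_zero n₁ hp) _)
  refine ⟨K₁ ×ˢ K₂, hK₁.prod hK₂, fun N hN q hq hq1 => ?_⟩
  have horb : (((q.1 : torusT W) : GA W))⁻¹ * GA.ofFinPart W γ₀ * ((q.2 : torusT' W) : GA W) ∈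
      levelDoubleCoset W (p ^ n₁) (GA.ofFinPart W γ₀) :=
    levelDoubleCoset_pow_antitone W p hN _ hq
  exact hmem q hq1 horb

/-- The fibre-compactness input with PROPER discharged by C-L4-PROPER (`hdet`, `hg`, `hreg`). -/
theorem exists_compact_suppSet_cut_subset_of_isLinRegular (hdet : W.B.det ≠ 0) (hg : Line1.IsGenuineRow W)
    (γ₀ : rationalPoints W) (hreg : Line1.IsLinRegular W γ₀) (DZf : Set (torusFin W))
    (hDZc : ∀ C : Set (torusFin W), IsCompact C → IsCompact (closure (DZf ∩ (C * (ZfIn W : Set (torusFin W))))))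
    {p : ℕ} (hp : p ≠ 0) (n₁ : ℕ) :
    ∃ C : Set (torusFin W × torusFin' W), IsCompact C ∧
      ∀ N ≥ n₁, ∀ q ∈ suppSet W (γ₀ : GA W) (p ^ N) (γ₀ : GA W), q.1 ∈ DZf → q ∈ C :=
  exists_compact_suppSet_cut_subset W (γ₀ : GA W) (hasProperFinOrbit_of_isLinRegular W hdet hg γ₀ hreg) DZf hDZc hp n₁

end LevelFibreCompact

end Summit.Ventures.HodgeRepro.Tier4.Line4
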